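/-
Origin: expansion seat `planner-pub-hodgecm-toy2-g5-0`, handover #4 2026-08-18T08:59:49Z (`HOME/pub-hodgecm-toy2-g5/lean/Toy2g5/PadH0Two.lean`, md5 396e54ef, 260 lines);
landed by the gen-7 packager in gate run 27 as `HodgeCM/Model/PadH0Two.lean` (import ^import Toy2g5\.PadH0\b→import HodgeCM.Model.PadH0 ×1; stripped 1 #print/#check/#eval lines).
-/
/-
Copyright: pub-hodgecm formalisation cell (harness21, 2026). New file (not vendored).
Origin: HOME/pub-hodgecm-toy2-g5/lean/Toy2g5/PadH0Two.lean — session planner-pub-hodgecm-toy2-g5-0 (unit pub-hodgecm-toy2-g5,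
CONSISTENCY seat 2, part (6a)(ii), generation 5).  WIP module `Toy2g5.PadH0Two`; intended final place
`HodgeCM/Model/PadH0Two.lean` (module `HodgeCM.Model.PadH0Two`).  ONE import to rewrite on landing:
`Toy2g5.PadH0` ↦ `HodgeCM.Model.PadH0`.
-/
import Summits.HodgeConjecture.HodgeCM.Model.PadH0_3
import Summits.HodgeConjecture.HodgeCM.Proofs.Pohlmann.WeightLines

/-!
# Datum B for the degree-zero pad: `P(X) = H²(X, ℚ)` of type `(0,0)` — N3 and Pohlmann's span inclusion fail

The pad datum `U.padDatumTwo`: `P(X) := H²(X, ℚ)` with the Hodge structure PURELY OF TYPE `(0,0)` (weight `0`,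
`F⁰ = everything`, `F¹ = 0`) and the pad action `P(f) := f^*|_{H²}`.  In the padded universe
`U♭² := U.padH0 U.padDatumTwo` (`HodgeCM.Model.PadH0`: `H♭⁰(X) = H⁰(X) ⊕ H²(X)`, degrees `≥ 1` unchanged):

* the pad laws hold when `U` is a model whose M14 domination witnesses can be taken with `N = 1`
  (`Fact_cmDominated1`, true in the exterior toy model — `HodgeCM.Model.Toy.ToyPadH0Two`), so `U♭²` is a model of the
  28 facts (`PadH0Two.modelAxioms`); N1, N2, **N4** (the pad has `F⁰ = ⊤`), F4, F5, `Fact_dimProd`, `W_RK4` transfer;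
* **`PohlmannSpan` FAILS in `U♭²`** (`PadH0Two.not_pohlmannSpan`, from `ModelAxioms` + N1 of `U` alone): the pad vector
  `(0, v)` of a class `0 ≠ v ∈ H²(A_Φ, ℚ)` is a rational Hodge class of `H♭⁰(A_Φ)` (the pad is of type `(0,0)`), but the
  span inclusion at `p = 0` asks it to lie in the span of the weight vectors of Hodge weights of size `2·0 = 0`, i.e. of
  the EMPTY weight; the pad component of such a weight vector is a weight vector of the empty weight in `H²(A_Φ, ℂ)`,
  and those vanish (`weightSpace_eq_bot_of_sum_card_ne`: in degree `2` only weights of size `2` occur) — so `v = 0`;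
* hence **N3 `Fact_pull_H0` FAILS in `U♭²`** whenever `U` has N1, N2, N4 (`PadH0Two.not_fact_pull_H0`, by
  `pohlmannSpan_of_facts` read contrapositively) — concretely, some CM multiplication acts non-trivially on `H²`, hence
  on `H♭⁰` (`PadH0Two.fact_pull_H0_iff`);
* COR-CM fails too (`not_hc_cm`: `(0, v)` is a Hodge class which is not algebraic).

So `U♭²` separates N3 from `ModelAxioms ∧ N1 ∧ N2 ∧ N4 ∧ F4 ∧ F5 ∧ Fact_dimProd ∧ W_RK4`, and PerL's conclusion-side
statements `PohlmannSpan`, `HC_CM` are false in it: the hypothesis N3 of `pohlmannSpan_of_facts` carries content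
(`PadH0Two.exists_model_not_fact_pull_H0`).  Unconditional instance on `toyModel`: `HodgeCM.Model.Toy.ToyPadH0Two`.
Nothing is cited; Lean + Mathlib axioms only.  `U♭²` has no print meaning (consistency device).
-/

noncomputable section

open scoped TensorProduct

namespace HodgeCM

open Literature.AlgebraicGeometry.Motives (CMType HodgeStructure)
open Literature.AlgebraicGeometry.Motives.HodgeStructure (ofRat pureFiltration pureFiltration_of_le)

namespace Universe

variable (U : Universe)

/-- **`Fact_cmDominated1`** — M14 `Fact_cmDominated` with domination degree `N = 1`: every CM abelian variety `X` of the
universe admits morphisms `s : X → A′ = ∏_{j ≤ n} A_{(F,Θ_j)}`, `π : A′ → X` (one Galois CM field `F` of degree `≥ 6`)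
with `(π ∘ s)^* = 1` on every `H^k(X, ℚ)`.  It holds in the exterior toy model, where a CM object is ISOMORPHIC to such a
product (`HodgeCM.Toy.fact_cmDominated1`); here it is only a HYPOTHESIS on the abstract universe (never cited). -/
def Fact_cmDominated1 : Prop :=
  ∀ X : U.Var, U.IsCMAbelianVariety X →
    ∃ F : CMField, IsGalois ℚ F ∧ 6 ≤ Module.finrank ℚ F ∧
      ∃ (n : ℕ) (Θ : Fin (n + 1) → CMType F) (s : U.Mor X (U.cmProd F Θ)) (π : U.Mor (U.cmProd F Θ) X),
        ∀ k : ℕ, U.pull (U.comp s π) k = LinearMap.id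

variable {U} in
/-- `Fact_cmDominated1` implies M14 `Fact_cmDominated` (with `N = 1`). -/
theorem fact_cmDominated_of_one (h : U.Fact_cmDominated1) : U.Fact_cmDominated := by
  intro X hX
  obtain ⟨F, hG, h6, n, Θ, s, π, hk⟩ := h X hX
  exact ⟨F, hG, h6, n, Θ, s, π, 1, one_ne_zero, fun k => by rw [hk k, Nat.cast_one, one_pow, one_smul]⟩

/-- **Datum B**: the pad `P(X) := H²(X, ℚ)` purely of type `(0,0)`, with the pad action `P(f) := f^*|_{H²}`. -/
def padDatumTwo : U.PadDatum where
  P X := U.Coh X 2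
  hs X := HodgeStructure.pure (U.Coh X 2) 0 ((0 : ℕ) : ℤ) (by norm_num)
  map f := U.pull f 2

namespace PadH0Two

variable {U}

/-- (Ported verbatim from the HodgeCMPerL package; no docstring in the source.) -/
theorem map_eq {X Y : U.Var} (f : U.Mor X Y) : U.padDatumTwo.map f = U.pull f 2 := rfl

/-- (Ported verbatim from the HodgeCMPerL package; no docstring in the source.) -/
theorem hs_F (X : U.Var) (p : ℤ) : (U.padDatumTwo.hs X).F p = pureFiltration (U.Coh X 2) 0 p := rfl

/-- The pad structure has `F⁰ = ⊤` … -/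
theorem hs_F_zero (X : U.Var) : (U.padDatumTwo.hs X).F 0 = ⊤ := by
  rw [hs_F]; exact pureFiltration_of_le le_rfl

/-- … so every rational pad vector is a rational Hodge class of it. -/
theorem pad_hodgeClasses (X : U.Var) : (U.padDatumTwo.hs X).hodgeClasses 0 = ⊤ :=
  eq_top_iff.mpr fun v _ => by
    rw [HodgeStructure.mem_hodgeClasses_iff, hs_F_zero]; exact Submodule.mem_top

/-! ## 1. `U♭²` is a model; transfers -/

/-- The pad laws hold when `U` is a model with `Fact_cmDominated1` (M1, M2 for `f^*|_{H²}`; every linear map preserves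
the one-step filtration; the `N = 1` domination witnesses act trivially on `H²`). -/
theorem laws (M : U.ModelAxioms) (h1 : U.Fact_cmDominated1) : U.padDatumTwo.Laws where
  map_id X := M.pull_id X 2
  map_comp X Y Z f g := M.pull_comp X Y Z f g 2
  map_hodge X Y f p := by
    rw [hs_F, hs_F]
    rintro _ ⟨x, hx, rfl⟩
    exact PadZero.map_mem_pureFiltration _ 0 p hx
  dominated X hX := by
    obtain ⟨F, hG, h6, n, Θ, s, π, hk⟩ := h1 X hX
    exact ⟨F, hG, h6, n, Θ, s, π, 1, one_ne_zero, fun k => by rw [hk k, Nat.cast_one, one_pow, one_smul], hk 2⟩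

/-- **`U♭²` is a model** whenever `U` is a model with `Fact_dimProd` and `Fact_cmDominated1`. -/
theorem modelAxioms (M : U.ModelAxioms) (hd : U.Fact_dimProd) (h1 : U.Fact_cmDominated1) :
    (U.padH0 U.padDatumTwo).ModelAxioms :=
  PadH0.modelAxioms M hd (laws M h1)

/-- **N4 transfers to `U♭²`** (the pad has `F⁰ = ⊤`). -/
theorem fact_hodge_F0 (h : U.Fact_hodge_F0) : (U.padH0 U.padDatumTwo).Fact_hodge_F0 :=
  PadH0.fact_hodge_F0_iff.mpr ⟨h, hs_F_zero⟩

/-- (Ported verbatim from the HodgeCMPerL package; no docstring in the source.) -/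
theorem fact_hodge_F0_iff : (U.padH0 U.padDatumTwo).Fact_hodge_F0 ↔ U.Fact_hodge_F0 :=
  ⟨fun h => (PadH0.fact_hodge_F0_iff.mp h).1, fact_hodge_F0⟩

/-- N3 holds in `U♭²` iff it holds in `U` AND every endomorphism acts trivially on `H²`. -/
theorem fact_pull_H0_iff :
    (U.padH0 U.padDatumTwo).Fact_pull_H0 ↔ U.Fact_pull_H0 ∧ ∀ (X : U.Var) (f : U.Mor X X), U.pull f 2 = LinearMap.id :=
  PadH0.fact_pull_H0_iff

/-- (Ported verbatim from the HodgeCMPerL package; no docstring in the source.) -/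
theorem fact_cupExterior_iff : (U.padH0 U.padDatumTwo).Fact_cupExterior ↔ U.Fact_cupExterior :=
  PadH0.fact_cupExterior_iff

/-- (Ported verbatim from the HodgeCMPerL package; no docstring in the source.) -/
theorem fact_cup_hodge (h : U.Fact_cup_hodge) : (U.padH0 U.padDatumTwo).Fact_cup_hodge := PadH0.fact_cup_hodge h

/-- (Ported verbatim from the HodgeCMPerL package; no docstring in the source.) -/
theorem fact_cupAlg (h : U.Fact_cupAlg) : (U.padH0 U.padDatumTwo).Fact_cupAlg := PadH0.fact_cupAlg h

/-- (Ported verbatim from the HodgeCMPerL package; no docstring in the source.) -/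
theorem fact_cupAssoc (h : U.Fact_cupAssoc) : (U.padH0 U.padDatumTwo).Fact_cupAssoc := PadH0.fact_cupAssoc h

/-- (Ported verbatim from the HodgeCMPerL package; no docstring in the source.) -/
theorem fact_dimProd_iff : (U.padH0 U.padDatumTwo).Fact_dimProd ↔ U.Fact_dimProd := Iff.rfl

/-- (Ported verbatim from the HodgeCMPerL package; no docstring in the source.) -/
theorem w_RK4_iff : (U.padH0 U.padDatumTwo).W_RK4 ↔ U.W_RK4 := Iff.rfl

/-! ## 2. `PohlmannSpan`, N3 and COR-CM fail in `U♭²` -/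

/-- **`H²(A_Φ, ℚ) ≠ 0`** for the CM abelian variety `A_Φ` of a CM type `Φ` of a CM field with at least two complex
embeddings, in any model with N1: `H²(A_Φ, ℂ)` contains the weight LINE of a weight of size `2` (`finrank_weightSpace`). -/
theorem exists_coh_two_ne_zero (M : U.ModelAxioms) (hN1 : U.Fact_cupExterior) (F : CMField)
    (h2 : 2 ≤ Module.finrank ℚ F) (Θ : Fin (0 + 1) → CMType F) : ∃ v : U.Coh (U.cmProd F Θ) 2, v ≠ 0 := by
  by_contra! h
  have hcard : 2 ≤ (Finset.univ : Finset ((F : Type) →+* ℂ)).card := by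
    rw [Finset.card_univ, NumberField.Embeddings.card]; exact h2
  obtain ⟨T, -, hT⟩ := Finset.exists_subset_card_eq hcard
  have hline : Module.finrank ℂ (U.weightSpace F Θ (fun _ => T) 2) = 1 := by
    rw [finrank_weightSpace M hN1 (by norm_num), if_pos]
    simp [hT]
  have hz : ∀ z : U.CohC (U.cmProd F Θ) 2, z = 0 := PadZero.forall_eq_zero_iff.mpr h
  have hpos : 0 < Module.finrank ℂ (U.weightSpace F Θ (fun _ => T) 2) := by rw [hline]; exact Nat.one_pos
  obtain ⟨w, hw⟩ := Module.finrank_pos_iff_exists_ne_zero.mp hpos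
  exact hw (Subtype.ext (hz _))

set_option smartUnfolding false in
/-- **Pohlmann's span inclusion FAILS in `U♭²`** (given `ModelAxioms` + N1 in `U`).  Take a Galois CM field `F` of degree
`≥ 6`, a CM type `Φ` (`faceHypothesesInhabited`) and `0 ≠ v ∈ H²(A_Φ, ℚ)` (`exists_coh_two_ne_zero`).  The pad vector
`(0, v) ∈ H♭⁰(A_Φ)` is a rational Hodge class; `PohlmannSpan` at `p = 0` would put `1 ⊗ (0, v)` in the `ℂ`-span of the
weight vectors of `H♭⁰(A_Φ, ℂ)` whose weight `S` is a Hodge weight for `p = 0`, i.e. has size `0`; the pad component of such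
a weight vector is a weight vector of weight `S` in `H²(A_Φ, ℂ)` (`PadH0.padOfC_weightVector`, the pad action being
`f^*|_{H²}`), and `V_S ∩ H² = 0` for `|S| = 0 ≠ 2` (`weightSpace_eq_bot_of_sum_card_ne`).  So the pad component `1 ⊗ v` of
`1 ⊗ (0, v)` vanishes: `v = 0`, contradiction. -/
theorem not_pohlmannSpan (M : U.ModelAxioms) (hN1 : U.Fact_cupExterior) : ¬ (U.padH0 U.padDatumTwo).PohlmannSpan := by
  intro hP
  obtain ⟨F, hG, h6, f, -, -⟩ := faceHypothesesInhabited
  let Θ : Fin (0 + 1) → CMType F := fun _ => f.Φ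
  -- a nonzero class of `H²(A_Φ, ℚ)`, typed as a pad vector of `A_Φ` in `U♭²` (the same type up to unfolding)
  obtain ⟨w, hw0⟩ : ∃ w : U.padDatumTwo.P ((U.padH0 U.padDatumTwo).cmProd F Θ), w ≠ 0 :=
    exists_coh_two_ne_zero M hN1 F (le_trans (by norm_num) h6) Θ
  -- the pad projection `H♭⁰(A_Φ, ℂ) → H²(A_Φ, ℂ)`
  let π : (U.padH0 U.padDatumTwo).CohC ((U.padH0 U.padDatumTwo).cmProd F Θ) (2 * 0) →ₗ[ℂ] U.CohC (U.cmProd F Θ) 2 :=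
    PadH0.padOfC U.padDatumTwo ((U.padH0 U.padDatumTwo).cmProd F Θ) (2 * 0)
  -- the generators of the span at `p = 0` have zero pad component
  have hgen : ∀ x : (U.padH0 U.padDatumTwo).CohC ((U.padH0 U.padDatumTwo).cmProd F Θ) (2 * 0),
      x ∈ {x : (U.padH0 U.padDatumTwo).CohC ((U.padH0 U.padDatumTwo).cmProd F Θ) (2 * 0) |
        ∃ S : Fin (0 + 1) → Finset ((F : Type) →+* ℂ), IsHodgeWeight Θ 0 S ∧
          (U.padH0 U.padDatumTwo).IsWeightVector F Θ S (2 * 0) x} → π x = 0 := by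
    rintro x ⟨S, hS, hx⟩
    have hsum : (∑ j, (S j).card) ≠ 2 := by rw [hS.1]; norm_num
    have hwv : U.IsWeightVector F Θ S 2 (π x) := fun j a N hN => PadH0.padOfC_weightVector Θ hx j a N hN
    have hmem : π x ∈ U.weightSpace F Θ S 2 := hwv
    rw [weightSpace_eq_bot_of_sum_card_ne M hN1 (by norm_num) hsum] at hmem
    exact (Submodule.mem_bot ℂ).mp hmem
  have hspan : Submodule.span ℂ {x : (U.padH0 U.padDatumTwo).CohC ((U.padH0 U.padDatumTwo).cmProd F Θ) (2 * 0) |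
        ∃ S : Fin (0 + 1) → Finset ((F : Type) →+* ℂ), IsHodgeWeight Θ 0 S ∧
          (U.padH0 U.padDatumTwo).IsWeightVector F Θ S (2 * 0) x} ≤ LinearMap.ker π :=
    Submodule.span_le.mpr fun x hx => LinearMap.mem_ker.mpr (hgen x hx)
  -- the pad vector `(0, w)` is a rational Hodge class of `H♭⁰(A_Φ)`, so `1 ⊗ (0, w)` lies in that span
  have hvH : w ∈ (U.padDatumTwo.hs ((U.padH0 U.padDatumTwo).cmProd F Θ)).hodgeClasses 0 := by
    rw [pad_hodgeClasses]; exact Submodule.mem_top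
  have hm := PadH0.ofPad_mem_hodgeClassesOf (D := U.padDatumTwo) ((U.padH0 U.padDatumTwo).cmProd F Θ) hvH
  have hsp := hP F hG h6 0 Θ 0 (Submodule.mem_map_of_mem hm)
  rw [Submodule.restrictScalars_mem] at hsp
  have hk := LinearMap.mem_ker.mp (hspan hsp)
  -- its pad component is `1 ⊗ w`, which therefore vanishes
  have hπ : π (ofRat (PadH0.ofPad U.padDatumTwo ((U.padH0 U.padDatumTwo).cmProd F Θ) 0 w)) = ofRat w := by
    show PadH0.padOfC U.padDatumTwo ((U.padH0 U.padDatumTwo).cmProd F Θ) 0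
      (ofRat (PadH0.ofPad U.padDatumTwo ((U.padH0 U.padDatumTwo).cmProd F Θ) 0 w)) = ofRat w
    rw [PadH0.padOfC_ofRat, PadH0.padOf_ofPad_zero]
  rw [hπ] at hk
  exact hw0 (PadZero.ofRat_injective (hk.trans
    (map_zero (ofRat : U.padDatumTwo.P ((U.padH0 U.padDatumTwo).cmProd F Θ) →ₗ[ℚ] _)).symm))

/-- **N3 `Fact_pull_H0` FAILS in `U♭²`** whenever `U` is a model with `Fact_dimProd`, `Fact_cmDominated1`, N1, N2 and N4:
otherwise `U♭²` would satisfy all hypotheses of `pohlmannSpan_of_facts`, contradicting `not_pohlmannSpan`. -/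
theorem not_fact_pull_H0 (M : U.ModelAxioms) (hd : U.Fact_dimProd) (h1 : U.Fact_cmDominated1)
    (hN1 : U.Fact_cupExterior) (hN2 : U.Fact_cup_hodge) (hN4 : U.Fact_hodge_F0) :
    ¬ (U.padH0 U.padDatumTwo).Fact_pull_H0 := fun h3 =>
  not_pohlmannSpan M hN1 (pohlmannSpan_of_facts (modelAxioms M hd h1) (fact_cupExterior_iff.mpr hN1)
    (fact_cup_hodge hN2) h3 (fact_hodge_F0 hN4))

/-- By-product: in a model with `Fact_dimProd`, `Fact_cmDominated1`, N1, N2, N3, N4 **some endomorphism acts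
non-trivially on some `H²(X, ℚ)`** (else N3 would transfer to `U♭²`). -/
theorem exists_pull_two_ne_id (M : U.ModelAxioms) (hd : U.Fact_dimProd) (h1 : U.Fact_cmDominated1)
    (hN1 : U.Fact_cupExterior) (hN2 : U.Fact_cup_hodge) (hN3 : U.Fact_pull_H0) (hN4 : U.Fact_hodge_F0) :
    ∃ (X : U.Var) (f : U.Mor X X), U.pull f 2 ≠ LinearMap.id := by
  by_contra! h
  exact not_fact_pull_H0 M hd h1 hN1 hN2 hN4 (fact_pull_H0_iff.mpr ⟨hN3, h⟩)

set_option smartUnfolding false in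
/-- **COR-CM FAILS in `U♭²`** (given `ModelAxioms` + N1 in `U`): the pad vector `(0, v)`, `0 ≠ v ∈ H²(A_Φ, ℚ)`, is a
rational Hodge class of `H♭⁰(A_Φ)` which is not algebraic (`Alg♭⁰ = Alg⁰ ⊕ 0`). -/
theorem not_hc_cm (M : U.ModelAxioms) (hN1 : U.Fact_cupExterior) : ¬ (U.padH0 U.padDatumTwo).HC_CM := by
  intro hHC
  obtain ⟨F, hG, h6, f, -, -⟩ := faceHypothesesInhabited
  let Θ : Fin (0 + 1) → CMType F := fun _ => f.Φ
  obtain ⟨w, hw0⟩ : ∃ w : U.padDatumTwo.P ((U.padH0 U.padDatumTwo).cmProd F Θ), w ≠ 0 :=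
    exists_coh_two_ne_zero M hN1 F (le_trans (by norm_num) h6) Θ
  have hX : (U.padH0 U.padDatumTwo).IsCMAbelianVariety ((U.padH0 U.padDatumTwo).cmProd F Θ) := (M.cmAV F f.Φ).2.1
  have hvH : w ∈ (U.padDatumTwo.hs ((U.padH0 U.padDatumTwo).cmProd F Θ)).hodgeClasses 0 := by
    rw [pad_hodgeClasses]; exact Submodule.mem_top
  have hm := PadH0.ofPad_mem_hodgeClassesOf (D := U.padDatumTwo) ((U.padH0 U.padDatumTwo).cmProd F Θ) hvH
  have hle := hHC _ hX 0
  exact hw0 ((PadH0.ofPad_mem_alg_iff (D := U.padDatumTwo) ((U.padH0 U.padDatumTwo).cmProd F Θ) w).mp (hle hm))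

/-- `RealisationExistsPerL` (hence PerL's conclusion `(COR-CM) ∧ RealisationExistsPerL`) fails in `U♭²` as soon as
COR-CM does. -/
theorem not_hc_cm_and (M : U.ModelAxioms) (hN1 : U.Fact_cupExterior) (Q : Prop) :
    ¬ ((U.padH0 U.padDatumTwo).HC_CM ∧ Q) := fun h => not_hc_cm M hN1 h.1

/-- **Separation theorem for N3.**  If `U` is a model with `Fact_dimProd`, `Fact_cmDominated1`, N1, N2, N4, F4, F5 and
`W_RK4`, then `U♭²` has all of these (and `Fact_cmDominated1`) and violates N3, Pohlmann's span inclusion and COR-CM: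
N3 is not a consequence of the other axioms and inputs of `pohlmannSpan_of_facts`, and without it the conclusion fails. -/
theorem exists_model_not_fact_pull_H0 (M : U.ModelAxioms) (hd : U.Fact_dimProd) (h1 : U.Fact_cmDominated1)
    (hN1 : U.Fact_cupExterior) (hN2 : U.Fact_cup_hodge) (hN4 : U.Fact_hodge_F0) (hF4 : U.Fact_cupAlg)
    (hF5 : U.Fact_cupAssoc) (hW : U.W_RK4) :
    ∃ U' : Universe, U'.ModelAxioms ∧ U'.Fact_dimProd ∧ U'.Fact_cupExterior ∧ U'.Fact_cup_hodge ∧ U'.Fact_hodge_F0 ∧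
      U'.Fact_cupAlg ∧ U'.Fact_cupAssoc ∧ U'.W_RK4 ∧
      ¬ U'.Fact_pull_H0 ∧ ¬ U'.PohlmannSpan ∧ ¬ U'.HC_CM :=
  ⟨U.padH0 U.padDatumTwo, modelAxioms M hd h1, fact_dimProd_iff.mpr hd, fact_cupExterior_iff.mpr hN1,
    fact_cup_hodge hN2, fact_hodge_F0 hN4, fact_cupAlg hF4, fact_cupAssoc hF5, w_RK4_iff.mpr hW,
    not_fact_pull_H0 M hd h1 hN1 hN2 hN4, not_pohlmannSpan M hN1, not_hc_cm M hN1⟩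


end PadH0Two

end Universe

end HodgeCM

end
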